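import Summits.FinalStateConjecture.FinalStateConjecture.Theorems.EIHFluxBalanceInertialRecessionVirialCore

/-!
# Route EIHFluxBalance — crux `InertialRecession`, abstract endgame for general `N`:
# the frozen-block virial inequality in integral form

Helper file for the crux `stmt-FinalStateConjecture-10166` (virial route; `InertialRecession_seat0_session8_note.md` §A).
Mathlib-only. `frozen_block_virial` with its two step sums replaced by the integral of the antitone error RATE
`ε = ε_a + 2^{|𝒦|} ε_b` over `[T, T + n h]` (`sum_mul_le_integral_of_antitone`): `frozen_block_virial_integral`.
-/

noncomputable section

open Finset MeasureTheory intervalIntegral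

namespace Summit.FinalStateConjecture.FinalStateConjecture.Theorems.SublinearIsFree.Virial

open Literature.Geometry.Lorentzian

variable {N : ℕ}

/-- The error RATE `ε_a + 2^{|𝒦|} ε_b` of the frozen-block virial inequality (with `d` the fine step) is antitone:
a nonnegative combination of the antitone envelopes `Fe, FΦ, Fζ`. [folklore] -/
theorem rate_antitone (𝒦 : Finset (Fin N)) (M : Fin N → ℝ) {C Λ k d : ℝ} {Fζ FΦ Fe : ℝ → ℝ} (hC : 0 ≤ C)
    (hΛ : 32 ≤ Λ) (hd : 0 < d) (hMK : 0 ≤ ∑ i ∈ 𝒦, M i)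
    (hFζa : Antitone Fζ) (hFΦa : Antitone FΦ) (hFea : Antitone Fe) :
    Antitone fun t ↦ (2 * (√(1 - k ^ 2))⁻¹ * (∑ i ∈ 𝒦, M i) * Fe t + 4 * 𝒦.card * (3 * (C * d * FΦ t + 2 * Fζ t))) +
      2 ^ 𝒦.card * (3 * (96 * (4 * Λ + 2) ^ N + 2 * d) * (C * FΦ t + 2 * Fζ t / d)) := by
  intro t t' htt'
  have h1 := hFea htt'; have h2 := hFΦa htt'; have h3 := hFζa htt'
  have hΛ0 : (0 : ℝ) ≤ 4 * Λ + 2 := by linarith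
  have hK : (0 : ℝ) ≤ 3 * (96 * (4 * Λ + 2) ^ N + 2 * d) := by positivity
  have hA : (0 : ℝ) ≤ 2 * (√(1 - k ^ 2))⁻¹ * ∑ i ∈ 𝒦, M i := by positivity
  have hB : (0 : ℝ) ≤ 4 * 𝒦.card := by positivity
  have hc : (0 : ℝ) ≤ 2 ^ 𝒦.card := by positivity
  have e1 : 2 * (√(1 - k ^ 2))⁻¹ * (∑ i ∈ 𝒦, M i) * Fe t' ≤ 2 * (√(1 - k ^ 2))⁻¹ * (∑ i ∈ 𝒦, M i) * Fe t :=
    mul_le_mul_of_nonneg_left h1 hA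
  have e2 : 3 * (C * d * FΦ t' + 2 * Fζ t') ≤ 3 * (C * d * FΦ t + 2 * Fζ t) := by
    have := mul_le_mul_of_nonneg_left h2 (by positivity : (0 : ℝ) ≤ C * d)
    linarith
  have e3 : C * FΦ t' + 2 * Fζ t' / d ≤ C * FΦ t + 2 * Fζ t / d := by
    have := mul_le_mul_of_nonneg_left h2 hC
    have := div_le_div_of_nonneg_right (mul_le_mul_of_nonneg_left h3 (by norm_num : (0:ℝ) ≤ 2)) hd.le
    linarith
  have e2' := mul_le_mul_of_nonneg_left e2 hB
  have e3' := mul_le_mul_of_nonneg_left (mul_le_mul_of_nonneg_left e3 hK) hc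
  beta_reduce
  linarith

/-- **The frozen-block virial inequality, integral form.** [folklore] -/
theorem frozen_block_virial_integral (ξ v : Fin N → ℝ → E3) (M : Fin N → ℝ) (𝒦 : Finset (Fin N))
    {κ δ C c₀ Λ h T TL k : ℝ} {k₀ n : ℕ} (ζ rmin Fζ FΦ Fe : ℝ → ℝ)
    (hNode : ∀ (t R : ℝ) (c : E3) (A : Finset (Fin N)), TL ≤ t → 0 < R → R ≤ c₀ * t →
      min (rmin t / (2 * (1 + 3 * δ))) (c₀ * t) ≤ R → ‖c‖ ≤ κ ^ 2 * t →
      (∀ j ∈ A, ‖ξ j t - c‖ ≤ (1 - 2 * δ) * R) → (∀ j ∉ A, (1 + 2 * δ) * R ≤ ‖ξ j t - c‖) →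
      ∀ s' ∈ Set.Icc t (t + δ * R),
        ‖∑ j ∈ A, (M j * (√(1 - ‖v j s'‖ ^ 2))⁻¹) • v j s' - ∑ j ∈ A, (M j * (√(1 - ‖v j t‖ ^ 2))⁻¹) • v j t‖ ≤
          3 * (C * ((s' - t) * (R ^ (3 / 2 : ℝ))⁻¹) + ζ t + ζ s'))
    (hC : 0 ≤ C) (hδ : 0 < δ) (hδ1 : δ ≤ 1 / 10) (hΛ : 32 ≤ Λ) (hΛκ : 2 * κ ^ 2 ≤ Λ * ((1 - 2 * δ) * c₀)) (hc₀ : 0 < c₀)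
    (hc₀1 : c₀ ≤ 1) (hh : 0 < h) (hT : 0 < T) (hTL : TL ≤ T) (hhT : h ≤ T)
    (hδ₁a : h / 2 ^ k₀ ≤ δ / (1 + 3 * δ)) (hδ₁b : h / 2 ^ k₀ * (2 * κ ^ 2) ≤ δ * c₀) (hδ₁c : h / 2 ^ k₀ ≤ 1 / 16)
    (hδ₁d : h / 2 ^ k₀ * (Λ + 1) ≤ 1 / 4)
    (hcone : ∀ (m : ℕ) (x : Fin N), ‖ξ x (T + m * h)‖ ≤ κ ^ 2 * (T + m * h))
    (hrmin : ∀ (m : ℕ) (x y : Fin N), x ≠ y → rmin (T + m * h) ≤ ‖ξ x (T + m * h) - ξ y (T + m * h)‖)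
    (hrmin0 : ∀ m : ℕ, 0 < rmin (T + m * h)) (hk₀r : ∀ m : ℕ, (2 : ℝ) ^ (k₀ + 1) ≤ rmin (T + m * h))
    (hmove : ∀ x (m m' : ℕ), m ≤ m' → ‖ξ x (T + m' * h) - ξ x (T + m * h)‖ ≤ (m' - m) * h)
    (hroot : ∀ m ≤ n, ∃ D G : ℝ, (∀ x ∈ 𝒦, ∀ y ∈ 𝒦, ‖ξ x (T + m * h) - ξ y (T + m * h)‖ ≤ D) ∧
      (∀ x ∈ 𝒦, ∀ z ∈ univ \ 𝒦, G ≤ ‖ξ x (T + m * h) - ξ z (T + m * h)‖) ∧ 1 * D < G)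
    (hFζ : ∀ s t : ℝ, T ≤ s → t / 2 ≤ s → ζ s ≤ Fζ t)
    (hFΦ : ∀ (m : ℕ) (t : ℝ), t / 2 ≤ T + m * h →
      (((1 + 3 * δ)⁻¹) ^ (3 / 2 : ℝ))⁻¹ * √2 * (√(rmin (T + m * h)))⁻¹ + 2 * κ ^ 2 * (c₀ ^ (3 / 2 : ℝ))⁻¹ * (√(T + m * h))⁻¹ ≤ FΦ t)
    (hFe : ∀ s t : ℝ, T ≤ s → t / 2 ≤ s → ∀ j, ‖deriv (ξ j) s - v j s‖ ≤ Fe t) (hFe1 : ∀ t, Fe t ≤ 1)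
    (hFζ0 : ∀ t, 0 ≤ Fζ t) (hFζ1 : ∀ t, Fζ t ≤ 1) (hFΦ0 : ∀ t, 0 ≤ FΦ t) (hFΦ1 : ∀ t, FΦ t ≤ 1)
    (hFζa : Antitone Fζ) (hFΦa : Antitone FΦ)
    (hM : ∀ i, 0 < M i) (hk : k < 1) (hvk : ∀ i t, ‖v i t‖ ≤ k) (hvc : ∀ i, Continuous (v i))
    (hξ : ∀ i, ContDiff ℝ ((⊤ : ℕ∞) : WithTop ℕ∞) (ξ i)) (h𝒦 : 2 ≤ 𝒦.card)
    {Dn : ℝ} (hDn0 : 0 ≤ Dn) (hDn : ∀ x ∈ 𝒦, ∀ y ∈ 𝒦, ‖ξ x (T + n * h) - ξ y (T + n * h)‖ ≤ Dn)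
    (hFea : Antitone Fe) :
    (2 * ∑ i ∈ 𝒦, M i)⁻¹ * (∫ s in T..(T + n * h), ∑ j ∈ 𝒦, ∑ l ∈ 𝒦, M j * M l * ‖v j s - v l s‖ ^ 2) -
        (∫ t in T..(T + n * h), ((2 * (√(1 - k ^ 2))⁻¹ * (∑ i ∈ 𝒦, M i) * Fe t +
          4 * 𝒦.card * (3 * (C * (h / 2 ^ k₀) * FΦ t + 2 * Fζ t))) +
        2 ^ 𝒦.card * (3 * (96 * (4 * Λ + 2) ^ N + 2 * (h / 2 ^ k₀)) * (C * FΦ t + 2 * Fζ t / (h / 2 ^ k₀))))) -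
        2 ^ 𝒦.card * (3 * (96 * (4 * Λ + 2) ^ N + 2 * (h / 2 ^ k₀)) * (C * (h / 2 ^ k₀) + 2) * (2 * Dn)) ≤
      (∑ j ∈ 𝒦, inner ℝ ((M j * (√(1 - ‖v j (T + n * h)‖ ^ 2))⁻¹) • v j (T + n * h))
        (ξ j (T + n * h) - (∑ l ∈ 𝒦, M l)⁻¹ • ∑ l ∈ 𝒦, M l • ξ l (T + n * h))) -
      (∑ j ∈ 𝒦, inner ℝ ((M j * (√(1 - ‖v j (T)‖ ^ 2))⁻¹) • v j (T))
        (ξ j (T) - (∑ l ∈ 𝒦, M l)⁻¹ • ∑ l ∈ 𝒦, M l • ξ l (T))) := by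
  have hmain := frozen_block_virial ξ v M 𝒦 ζ rmin Fζ FΦ Fe hNode hC hδ hδ1 hΛ hΛκ hc₀ hc₀1 hh hT hTL hhT hδ₁a hδ₁b hδ₁c hδ₁d
    hcone hrmin hrmin0 hk₀r hmove hroot hFζ hFΦ hFe hFe1 hFζ0 hFζ1 hFΦ0 hFΦ1 hFζa hFΦa hM hk hvk hvc hξ h𝒦 hDn0 hDn
  refine le_trans ?_ hmain
  -- the rate is antitone
  have hMK : 0 ≤ ∑ i ∈ 𝒦, M i := Finset.sum_nonneg fun i _ ↦ (hM i).le
  have hδ₁0 : 0 < h / 2 ^ k₀ := by positivity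
  have hanti := rate_antitone 𝒦 M (N := N) (C := C) (Λ := Λ) (k := k) (d := h / 2 ^ k₀) hC hΛ hδ₁0 hMK hFζa hFΦa hFea
  have hsum := sum_mul_le_integral_of_antitone hanti hh.le (T := T) n
  beta_reduce at hsum
  have hsum' : (∑ i ∈ range n, h * (2 * (√(1 - k ^ 2))⁻¹ * (∑ i ∈ 𝒦, M i) * Fe (T + (i + 1 : ℕ) * h) +
          4 * 𝒦.card * (3 * (C * (h / 2 ^ k₀) * FΦ (T + (i + 1 : ℕ) * h) + 2 * Fζ (T + (i + 1 : ℕ) * h))))) +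
      (2 : ℝ) ^ 𝒦.card * (∑ i ∈ range n, h * (3 * (96 * (4 * Λ + 2) ^ N + 2 * (h / 2 ^ k₀)) *
        (C * FΦ (T + (i + 1 : ℕ) * h) + 2 * Fζ (T + (i + 1 : ℕ) * h) / (h / 2 ^ k₀)))) ≤
      ∫ t in T..(T + n * h), ((2 * (√(1 - k ^ 2))⁻¹ * (∑ i ∈ 𝒦, M i) * Fe t +
          4 * 𝒦.card * (3 * (C * (h / 2 ^ k₀) * FΦ t + 2 * Fζ t))) +
        2 ^ 𝒦.card * (3 * (96 * (4 * Λ + 2) ^ N + 2 * (h / 2 ^ k₀)) * (C * FΦ t + 2 * Fζ t / (h / 2 ^ k₀)))) := by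
    have e1 : (2 : ℝ) ^ 𝒦.card * (∑ i ∈ range n, h * (3 * (96 * (4 * Λ + 2) ^ N + 2 * (h / 2 ^ k₀)) *
        (C * FΦ (T + (i + 1 : ℕ) * h) + 2 * Fζ (T + (i + 1 : ℕ) * h) / (h / 2 ^ k₀)))) =
        ∑ i ∈ range n, (2 : ℝ) ^ 𝒦.card * (h * (3 * (96 * (4 * Λ + 2) ^ N + 2 * (h / 2 ^ k₀)) *
        (C * FΦ (T + (i + 1 : ℕ) * h) + 2 * Fζ (T + (i + 1 : ℕ) * h) / (h / 2 ^ k₀)))) := Finset.mul_sum _ _ _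
    rw [e1, ← Finset.sum_add_distrib]
    refine le_trans (le_of_eq (Finset.sum_congr rfl fun i _ ↦ by ring)) hsum
  have hdist : (2 : ℝ) ^ 𝒦.card * ((∑ i ∈ range n, h * (3 * (96 * (4 * Λ + 2) ^ N + 2 * (h / 2 ^ k₀)) *
      (C * FΦ (T + (i + 1 : ℕ) * h) + 2 * Fζ (T + (i + 1 : ℕ) * h) / (h / 2 ^ k₀)))) +
      3 * (96 * (4 * Λ + 2) ^ N + 2 * (h / 2 ^ k₀)) * (C * (h / 2 ^ k₀) + 2) * (2 * Dn)) =
      (2 : ℝ) ^ 𝒦.card * (∑ i ∈ range n, h * (3 * (96 * (4 * Λ + 2) ^ N + 2 * (h / 2 ^ k₀)) *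
        (C * FΦ (T + (i + 1 : ℕ) * h) + 2 * Fζ (T + (i + 1 : ℕ) * h) / (h / 2 ^ k₀)))) +
      (2 : ℝ) ^ 𝒦.card * (3 * (96 * (4 * Λ + 2) ^ N + 2 * (h / 2 ^ k₀)) * (C * (h / 2 ^ k₀) + 2) * (2 * Dn)) :=
    mul_add _ _ _
  rw [hdist]
  linarith [hsum']

/-- Registered one-line form of `rate_antitone`. [folklore] -/
theorem rate_antitone' : open Finset in ∀ {N : ℕ} (𝒦 : Finset (Fin N)) (M : Fin N → ℝ) {C Λ k d : ℝ} {Fζ FΦ Fe : ℝ → ℝ}, 0 ≤ C → 32 ≤ Λ → 0 < d → 0 ≤ ∑ i ∈ 𝒦, M i → Antitone Fζ → Antitone FΦ → Antitone Fe → Antitone fun t ↦ (2 * (√(1 - k ^ 2))⁻¹ * (∑ i ∈ 𝒦, M i) * Fe t + 4 * 𝒦.card * (3 * (C * d * FΦ t + 2 * Fζ t))) + 2 ^ 𝒦.card * (3 * (96 * (4 * Λ + 2) ^ N + 2 * d) * (C * FΦ t + 2 * Fζ t / d)) :=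
  fun 𝒦 M _ _ _ _ _ _ _ hC hΛ hd hMK hFζa hFΦa hFea ↦ rate_antitone 𝒦 M hC hΛ hd hMK hFζa hFΦa hFea

end Summit.FinalStateConjecture.FinalStateConjecture.Theorems.SublinearIsFree.Virial

end
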